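import Mathlib
import Literature.Analysis.Complex.ArgumentPrincipleRectangle
import Summits.ValiantsHypothesis.ValiantsHypothesis.Theorems.LacunarySymmetroidMatrixDescartesRoucheWindowKit

/-!
# `MatrixDescartes` — kit for the LETTER-SEPARATED SECTOR, II: orders of zeros on a rectangle; the two-letter
# determinant along `exp` has at most `m` zeros, with multiplicity, in a strip of half-height `π/g`

HONEST FRAMING.  Object-search cell `pub-symmetroid`, crux `Theses.LacunarySymmetroid.MatrixDescartes`
(ledger item `stmt-ValiantsHypothesis-18050`, route `LacunarySymmetroid`; seat `val-sym-mdr-p2`, gen 12).  The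
crux implies `VP ≠ VNP` by the route's assembly; NOTHING here is progress on it and nothing here is a claim
about `VP ≠ VNP`, `DoorA26` / `DoorA34` or the cell's registers.  Bookkeeping for the structural two-letter
window law in the logarithmic variable `t` (`x = e^t`):

* §3 **Orders** (`untop₀_meromorphicOrderAt_eq`, `finsum_order_eq_natCast`, `one_le_analyticOrderNatAt`): on a
  closed rectangle where `Φ` is analytic and somewhere nonzero, the `ℂ`-valued zero count of the tree's
  argument principle (`∑ᶠ (meromorphicOrderAt Φ ρ).untop₀`) is the natural number `∑ analyticOrderNatAt Φ ρ`
  over the finite zero set (`Literature.Analysis.Complex.finite_zeros_reProdIm`), each zero counting `≥ 1`.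
* §4 **The two-letter comparison along `exp`** (`twoLetter_exp_eq`, `analyticOrderNatAt_twoLetter_exp`,
  `exp_mul_injOn_strip`, `sum_analyticOrderNatAt_twoLetter_exp_le`): for complex `m × m` letters `A, B` and
  exponents `d_a < d_b` (gap `g`), `det(e^(d_a t)A + e^(d_b t)B) = e^(m d_a t)·p(e^(g t))` with
  `p = det(X • B + A)` (`deg p ≤ m`, kit `RoucheWindow.det_twoLetter_eq`); the order of a zero `ρ` is the root
  multiplicity of `p` at `e^(g ρ)` (Mathlib `analyticOrderAt_comp_of_deriv_ne_zero` + kit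
  `RoucheWindow.analyticOrderNatAt_eval_eq_rootMultiplicity`), `t ↦ e^(g t)` is injective on any strip
  `|Im t| < h ≤ π/g`, hence the zeros in such a strip, counted with multiplicity, number at most `m` — the
  count that Rouché on a rectangle transfers to the full pencil.

[folklore] Elementary; Mathlib `Complex.exp_eq_exp_iff_exists_int`, `analyticOrderAt_mul`,
`AnalyticAt.meromorphicOrderAt_eq`.
-/

-- `Summit.ValiantsHypothesis.ValiantsHypothesis.…` repeats a component by the D-0017 layout
-- (single-conjunct summit), which the `dupNamespace` linter flags; the name is mandated.
set_option linter.dupNamespace false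

namespace Summit.ValiantsHypothesis.ValiantsHypothesis.Theorems.LacunarySymmetroidMatrixDescartes.Separated

open Polynomial Complex Set Finset
open scoped BigOperators Matrix Real

/-! ## §3 Orders of zeros: bookkeeping between `meromorphicOrderAt`, `analyticOrderNatAt`, root multiplicity -/

/-- For a function analytic at `ρ`, the integer `(meromorphicOrderAt Φ ρ).untop₀` is the natural number
`analyticOrderNatAt Φ ρ`. [folklore] -/
theorem untop₀_meromorphicOrderAt_eq {Φ : ℂ → ℂ} {ρ : ℂ} (hΦ : AnalyticAt ℂ Φ ρ) :
    (meromorphicOrderAt Φ ρ).untop₀ = (analyticOrderNatAt Φ ρ : ℤ) := by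
  rw [hΦ.meromorphicOrderAt_eq, analyticOrderNatAt]
  cases analyticOrderAt Φ ρ with
  | top => simp
  | coe n => simp

section Rect
variable {a b c d : ℝ}

/-- On a closed rectangle where `Φ` is analytic and not identically zero (nonzero at some point `w`), the
`ℂ`-valued count of zeros of the tree's argument principle is the natural number
`∑ analyticOrderNatAt` over the finite zero set. [folklore] -/
theorem finsum_order_eq_natCast {Φ : ℂ → ℂ} (hab : a ≤ b) (hcd : c ≤ d)
    (hΦ : AnalyticOnNhd ℂ Φ (Icc a b ×ℂ Icc c d)) {w : ℂ} (hw : w ∈ Icc a b ×ℂ Icc c d) (hΦw : Φ w ≠ 0) :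
    ∑ᶠ ρ ∈ {ρ : ℂ | Φ ρ = 0 ∧ ρ ∈ Ioo a b ×ℂ Ioo c d}, ((meromorphicOrderAt Φ ρ).untop₀ : ℂ) =
      ((∑ ρ ∈ (Literature.Analysis.Complex.finite_zeros_reProdIm hab hcd hΦ hw hΦw).toFinset,
        analyticOrderNatAt Φ ρ : ℕ) : ℂ) := by
  rw [finsum_mem_eq_finite_toFinset_sum _
    (Literature.Analysis.Complex.finite_zeros_reProdIm hab hcd hΦ hw hΦw), Nat.cast_sum]
  refine sum_congr rfl fun ρ hρ => ?_
  rw [Set.Finite.mem_toFinset] at hρ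
  have hρK : ρ ∈ Icc a b ×ℂ Icc c d := ⟨Ioo_subset_Icc_self hρ.2.1, Ioo_subset_Icc_self hρ.2.2⟩
  rw [untop₀_meromorphicOrderAt_eq (hΦ ρ hρK)]
  simp

/-- Each zero of `Φ` in the rectangle has order at least one (the function is not locally zero). [folklore] -/
theorem one_le_analyticOrderNatAt {Φ : ℂ → ℂ} (hab : a ≤ b) (hcd : c ≤ d)
    (hΦ : AnalyticOnNhd ℂ Φ (Icc a b ×ℂ Icc c d)) {w : ℂ} (hw : w ∈ Icc a b ×ℂ Icc c d) (hΦw : Φ w ≠ 0)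
    {ρ : ℂ} (hρ : ρ ∈ Icc a b ×ℂ Icc c d) (hρ0 : Φ ρ = 0) : 1 ≤ analyticOrderNatAt Φ ρ := by
  have hne := Literature.Analysis.Complex.analyticOrderAt_ne_top_of_reProdIm hab hcd hΦ hw hΦw hρ
  rw [analyticOrderNatAt]
  cases h : analyticOrderAt Φ ρ with
  | top => exact absurd h hne
  | coe n =>
    simp only [ENat.toNat_coe]
    by_contra hlt
    have hn0 : n = 0 := by omega
    subst hn0
    have h0 : analyticOrderAt Φ ρ = 0 := by rw [h]; rfl
    exact ((hΦ ρ hρ).analyticOrderAt_eq_zero.1 h0) hρ0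

end Rect

/-! ## §4 The two-letter comparison along `exp`: at most `m` zeros, with multiplicity, in a strip of
half-height `π/g` -/

/-- `t ↦ exp (g t)` is injective on the strip `|Im t| < h` when `h ≤ π/g` (`g ≥ 1`). [folklore] -/
theorem exp_mul_injOn_strip {g : ℕ} (hg : 1 ≤ g) {h : ℝ} (hh : h ≤ π / g) {ρ ρ' : ℂ}
    (hρ : |ρ.im| < h) (hρ' : |ρ'.im| < h) (he : exp ((g : ℂ) * ρ) = exp ((g : ℂ) * ρ')) : ρ = ρ' := by
  obtain ⟨n, hn⟩ := Complex.exp_eq_exp_iff_exists_int.1 he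
  have hg0 : (0 : ℝ) < g := by exact_mod_cast hg
  have him := congrArg Complex.im hn
  simp only [mul_im, natCast_re, natCast_im, zero_mul, add_zero, add_im, mul_re, intCast_re, intCast_im,
    ofReal_re, ofReal_im, I_re, I_im, mul_zero, sub_zero, mul_one, re_ofNat, im_ofNat] at him
  -- `him : g * ρ.im = g * ρ'.im + n * (2 * π)`
  obtain ⟨hρ1, hρ2⟩ := abs_lt.1 hρ
  obtain ⟨hρ1', hρ2'⟩ := abs_lt.1 hρ'
  have hbound : |(n : ℝ)| * (2 * π) < 2 * π := by
    have h1 : (n : ℝ) * (2 * π) = g * (ρ.im - ρ'.im) := by linarith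
    have h2 : |ρ.im - ρ'.im| < 2 * h := abs_sub_lt_iff.2 ⟨by linarith, by linarith⟩
    have h3 : (g : ℝ) * |ρ.im - ρ'.im| < 2 * π :=
      calc (g : ℝ) * |ρ.im - ρ'.im| < g * (2 * h) := mul_lt_mul_of_pos_left h2 hg0
        _ ≤ g * (2 * (π / g)) := by gcongr
        _ = 2 * π := by field_simp
    calc |(n : ℝ)| * (2 * π) = |(n : ℝ) * (2 * π)| := by
          rw [abs_mul, abs_of_pos Real.two_pi_pos]
      _ = (g : ℝ) * |ρ.im - ρ'.im| := by rw [h1, abs_mul, abs_of_pos hg0]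
      _ < 2 * π := h3
  have hn0 : n = 0 := by
    have h1 : |(n : ℝ)| < 1 := by
      by_contra hc
      rw [not_lt] at hc
      have := mul_le_mul_of_nonneg_right hc Real.two_pi_pos.le
      linarith
    have h2 : |(n : ℝ)| = ((|n| : ℤ) : ℝ) := (Int.cast_abs).symm
    rw [h2] at h1
    have h3 : |n| < 1 := by exact_mod_cast h1
    have h4 : 0 ≤ |n| := abs_nonneg n
    have h5 : |n| = 0 := by omega
    exact abs_eq_zero.1 h5
  rw [hn0] at hn
  simp only [Int.cast_zero, zero_mul, add_zero] at hn
  have hg' : (g : ℂ) ≠ 0 := by exact_mod_cast (show g ≠ 0 by omega)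
  exact mul_left_cancel₀ hg' hn


/-- The two-letter determinant along `exp`: `det(e^(d_a t) A + e^(d_b t) B) = (e^t)^(d_a m) · p(e^(g t))` with
`p = det (X • B + A)`, `g = d_b − d_a`. [folklore] -/
theorem twoLetter_exp_eq {m da db : ℕ} (hab : da < db) (A B : Matrix (Fin m) (Fin m) ℂ) (t : ℂ) :
    (Matrix.det (((X : ℂ[X]) ^ da) • A.map C + ((X : ℂ[X]) ^ db) • B.map C)).eval (exp t) =
      exp t ^ (da * m) * (Matrix.det ((X : ℂ[X]) • B.map C + A.map C)).eval (exp (((db - da : ℕ) : ℂ) * t)) := by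
  rw [RoucheWindow.det_twoLetter_eq hab, eval_mul, eval_pow, eval_pow, eval_X, eval_comp, eval_pow, eval_X,
    ← pow_mul, Complex.exp_nat_mul]

/-- Order of a zero of the two-letter determinant along `exp` = root multiplicity of `p` at `e^(g ρ)`. [folklore] -/
theorem analyticOrderNatAt_twoLetter_exp {m da db : ℕ} (hab : da < db) (A B : Matrix (Fin m) (Fin m) ℂ)
    (hp : Matrix.det ((X : ℂ[X]) • B.map C + A.map C) ≠ 0) (ρ : ℂ) :
    analyticOrderNatAt (fun t => (Matrix.det (((X : ℂ[X]) ^ da) • A.map C +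
        ((X : ℂ[X]) ^ db) • B.map C)).eval (exp t)) ρ =
      (Matrix.det ((X : ℂ[X]) • B.map C + A.map C)).rootMultiplicity (exp (((db - da : ℕ) : ℂ) * ρ)) := by
  set p : ℂ[X] := Matrix.det ((X : ℂ[X]) • B.map C + A.map C) with hp_def
  set g : ℕ := db - da with hg_def
  have hg : 1 ≤ g := by omega
  have hfun : (fun t => (Matrix.det (((X : ℂ[X]) ^ da) • A.map C + ((X : ℂ[X]) ^ db) • B.map C)).eval (exp t))
      = (fun t => exp t ^ (da * m)) * ((fun w => p.eval w) ∘ (fun t => exp ((g : ℂ) * t))) := by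
    funext t
    simp only [Pi.mul_apply, Function.comp_apply]
    exact twoLetter_exp_eq hab A B t
  have h1 : AnalyticAt ℂ (fun t => exp t ^ (da * m)) ρ := by fun_prop
  have h2i : AnalyticAt ℂ (fun t => exp ((g : ℂ) * t)) ρ := by fun_prop
  have h2 : AnalyticAt ℂ ((fun w => p.eval w) ∘ (fun t => exp ((g : ℂ) * t))) ρ :=
    ((AnalyticOnNhd.eval_polynomial p) _ (Set.mem_univ _)).comp h2i
  have hderiv : deriv (fun t => exp ((g : ℂ) * t)) ρ ≠ 0 := by
    have hd : HasDerivAt (fun t => exp ((g : ℂ) * t)) (exp ((g : ℂ) * ρ) * ((g : ℂ) * 1)) ρ :=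
      (Complex.hasDerivAt_exp _).comp ρ ((hasDerivAt_id ρ).const_mul (g : ℂ))
    rw [hd.deriv, mul_one]
    exact mul_ne_zero (exp_ne_zero _) (by exact_mod_cast (show g ≠ 0 by omega))
  have hord1 : analyticOrderAt (fun t => exp t ^ (da * m)) ρ = 0 :=
    h1.analyticOrderAt_eq_zero.2 (pow_ne_zero _ (exp_ne_zero _))
  have key : analyticOrderAt (fun t => (Matrix.det (((X : ℂ[X]) ^ da) • A.map C +
        ((X : ℂ[X]) ^ db) • B.map C)).eval (exp t)) ρ =
      analyticOrderAt (fun w => p.eval w) (exp ((g : ℂ) * ρ)) := by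
    rw [hfun, analyticOrderAt_mul h1 h2, hord1, zero_add, analyticOrderAt_comp_of_deriv_ne_zero h2i hderiv]
  have h3 := RoucheWindow.analyticOrderNatAt_eval_eq_rootMultiplicity hp (exp ((g : ℂ) * ρ))
  have h4 := congrArg ENat.toNat key
  exact h4.trans h3

/-- **At most `m` zeros with multiplicity in a strip of half-height `≤ π/g`.**  For any finite set `T` of
zeros of the two-letter determinant along `exp` lying in the strip `|Im t| < h`, `h ≤ π/g`, the orders add
up to at most `m` (`p` has at most `m` roots with multiplicity and `t ↦ e^(g t)` is injective on the strip).
[folklore] -/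
theorem sum_analyticOrderNatAt_twoLetter_exp_le {m da db : ℕ} (hab : da < db) (A B : Matrix (Fin m) (Fin m) ℂ)
    (hp : Matrix.det ((X : ℂ[X]) • B.map C + A.map C) ≠ 0) {h : ℝ} (hh : h ≤ π / (db - da : ℕ))
    (T : Finset ℂ) (hT : ∀ ρ ∈ T, |ρ.im| < h ∧
      (Matrix.det (((X : ℂ[X]) ^ da) • A.map C + ((X : ℂ[X]) ^ db) • B.map C)).eval (exp ρ) = 0) :
    ∑ ρ ∈ T, analyticOrderNatAt (fun t => (Matrix.det (((X : ℂ[X]) ^ da) • A.map C +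
        ((X : ℂ[X]) ^ db) • B.map C)).eval (exp t)) ρ ≤ m := by
  classical
  set p : ℂ[X] := Matrix.det ((X : ℂ[X]) • B.map C + A.map C) with hp_def
  set g : ℕ := db - da with hg_def
  have hg : 1 ≤ g := by omega
  set φ : ℂ → ℂ := fun ρ => exp ((g : ℂ) * ρ) with hφ
  have hinj : Set.InjOn φ T := fun ρ hρ ρ' hρ' he =>
    exp_mul_injOn_strip hg hh (hT ρ hρ).1 (hT ρ' hρ').1 he
  have himg : T.image φ ⊆ p.roots.toFinset := by
    intro y hy
    obtain ⟨ρ, hρ, rfl⟩ := mem_image.1 hy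
    rw [Multiset.mem_toFinset, mem_roots hp, IsRoot.def]
    have h0 := (hT ρ hρ).2
    rw [twoLetter_exp_eq hab] at h0
    exact (mul_eq_zero.1 h0).resolve_left (pow_ne_zero _ (exp_ne_zero _))
  calc ∑ ρ ∈ T, analyticOrderNatAt (fun t => (Matrix.det (((X : ℂ[X]) ^ da) • A.map C +
          ((X : ℂ[X]) ^ db) • B.map C)).eval (exp t)) ρ
      = ∑ ρ ∈ T, p.rootMultiplicity (φ ρ) :=
        sum_congr rfl fun ρ _ => analyticOrderNatAt_twoLetter_exp hab A B hp ρ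
    _ = ∑ y ∈ T.image φ, p.rootMultiplicity y := by
        rw [Finset.sum_image (f := fun y => p.rootMultiplicity y) hinj]
    _ ≤ ∑ y ∈ p.roots.toFinset, p.rootMultiplicity y :=
        sum_le_sum_of_subset_of_nonneg himg fun _ _ _ => Nat.zero_le _
    _ = Multiset.card p.roots := by
        rw [← Multiset.toFinset_sum_count_eq]
        exact sum_congr rfl fun y _ => (count_roots p).symm
    _ ≤ p.natDegree := card_roots' p
    _ ≤ m := by
        have := natDegree_det_X_add_C_le B A
        rwa [Fintype.card_fin] at this

end Summit.ValiantsHypothesis.ValiantsHypothesis.Theorems.LacunarySymmetroidMatrixDescartes.Separated
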